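import Mathlib
import Summits.CriticalPhenomena.Ising3DConformalLimit.Theorems.PerfectScreeningMixedSpectralRepresentation
import Literature.Probability.LatticeModels.HighDimPointwiseTriviality

/-!
# Crux `CriticalTwoPointGSM`, line `Sketch` (canonical-lift spine, seat c1) — stub `js_approximants`

The finite-`N` joint spectral measures of the critical two-point function
`G = ⟨σ₀σ_·⟩⁺_{β_c}` of the nearest-neighbour Ising model on `ℤ³` (sites written `Fin.cons n z`,
`n ∈ ℤ` axial, `z ∈ ℤ²` transverse).

For `N ≥ 1` let `box = [0,N)² ⊆ ℤ²`, `grid = (-N,N]² ⊆ ℤ²`, and for `j ∈ grid` let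
`μ_{c,j}`, `μ_{s,j}` be the Hausdorff measures on `[0,1]` of the real coefficient vectors
`x ↦ cos(π j·x/N)`, `x ↦ sin(π j·x/N)` on `box`, given by the PROVED quadratic-form spectral
representation `Theorems.mixedSpectralRepresentation_proof`
(`∑_{x,y ∈ box} v_x v_y G(n, x-y) = ∫ t^{|n|} dμ_v`). Pushing `μ_{c,j} + μ_{s,j}` to the momentum
`k_j = πj/N` by `t ↦ (t, k_j)` and summing over `j ∈ grid` with the weight `(N²(2N)²)⁻¹` gives a
measure `ρ_N` on `ℝ³` carried by `[0,1]×[-π,π]²` whose joint moments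
`∫ λ^{|n|} cos(k·z) dρ_N` are, by the collapsed identity of `js_cesaroIdentity` (hypothesis `hces`),
the Cesàro-weighted values `#{(x,y) ∈ box² : x-y = z}·G(n,z)/N²`; at `n = 0`, `z = 0` this is
`G(0) = 1`, so `ρ_N` is a probability measure. This is the theorem `js_approximants` below; the
helper lemmas (push-forwards `t ↦ (t, k)` of axis measures, the diagonal pair count) are in the
sub-namespace `CriticalTwoPointGSMJs.JsApproximants`.
-/

noncomputable section

namespace Summit.CriticalPhenomena.Ising3DConformalLimit.Theorems

open MeasureTheory Filter Topology
open Literature.Probability.LatticeModels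
open scoped BigOperators

namespace CriticalTwoPointGSMJs.JsApproximants

/-- The Hausdorff representation of the axial quadratic forms of `G` (the PROVED item
`Theorems.mixedSpectralRepresentation_proof`, restated with its definition unfolded). -/
theorem exists_hausdorff (s : Finset (Fin 2 → ℤ)) (v : (Fin 2 → ℤ) → ℝ) :
    ∃ μ : Measure ℝ, IsFiniteMeasure μ ∧ μ (Set.Icc (0 : ℝ) 1)ᶜ = 0 ∧
      ∀ n : ℤ, ∑ x ∈ s, ∑ y ∈ s, v x * v y * criticalTwoPoint 3 (Fin.cons n (x - y)) =
        ∫ t, t ^ n.natAbs ∂μ :=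
  mixedSpectralRepresentation_proof s v

/-- The embedding `t ↦ (t, k)` of the spectral axis at a fixed momentum `k` is measurable. -/
theorem measurable_cons (k : Fin 2 → ℝ) :
    Measurable (fun t : ℝ => (Fin.cons t k : Fin 3 → ℝ)) :=
  (continuous_id.finCons continuous_const).measurable

/-- The box `[0,1]×[-π,π]²` carrying the joint spectral measures is measurable. -/
theorem measurableSet_box :
    MeasurableSet {p : Fin 3 → ℝ | 0 ≤ p 0 ∧ p 0 ≤ 1 ∧
      ∀ j : Fin 2, -Real.pi ≤ p j.succ ∧ p j.succ ≤ Real.pi} := by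
  simp only [Set.setOf_and, Set.setOf_forall]
  exact (measurableSet_le measurable_const (measurable_pi_apply 0)).inter
    ((measurableSet_le (measurable_pi_apply 0) measurable_const).inter
      (MeasurableSet.iInter fun j => (measurableSet_le measurable_const
        (measurable_pi_apply _)).inter (measurableSet_le (measurable_pi_apply _) measurable_const)))

/-- The discrete momenta `k_j = πj/N`, `j ∈ (-N,N]²`, lie in `[-π,π]²`. -/
theorem momentum_mem {N : ℕ} (hN : 1 ≤ N) {j : Fin 2 → ℤ}
    (hj : j ∈ Fintype.piFinset (fun _ : Fin 2 => Finset.Ioc (-(N : ℤ)) N)) (i : Fin 2) :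
    -Real.pi ≤ Real.pi * (j i : ℝ) / N ∧ Real.pi * (j i : ℝ) / N ≤ Real.pi := by
  have hNpos : (0 : ℝ) < N := by exact_mod_cast hN
  have hi := Fintype.mem_piFinset.1 hj i
  rw [Finset.mem_Ioc] at hi
  have h1 : (-(N : ℝ)) ≤ j i := by exact_mod_cast hi.1.le
  have h2 : (j i : ℝ) ≤ N := by exact_mod_cast hi.2
  rw [le_div_iff₀ hNpos, div_le_iff₀ hNpos]
  constructor <;> nlinarith [Real.pi_pos]

/-- A measure on the spectral axis carried by `[0,1]`, pushed to a momentum `k ∈ [-π,π]²`, is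
carried by the box `[0,1]×[-π,π]²`. -/
theorem map_cons_compl_box {k : Fin 2 → ℝ} (hk : ∀ i : Fin 2, -Real.pi ≤ k i ∧ k i ≤ Real.pi)
    (ν : Measure ℝ) (hν : ν (Set.Icc (0 : ℝ) 1)ᶜ = 0) :
    (ν.map (fun t : ℝ => (Fin.cons t k : Fin 3 → ℝ))) {p : Fin 3 → ℝ | 0 ≤ p 0 ∧ p 0 ≤ 1 ∧
      ∀ j : Fin 2, -Real.pi ≤ p j.succ ∧ p j.succ ≤ Real.pi}ᶜ = 0 := by
  rw [Measure.map_apply (measurable_cons k) measurableSet_box.compl]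
  refine measure_mono_null (fun t ht => ?_) hν
  simp only [Set.mem_preimage, Set.mem_compl_iff, Set.mem_setOf_eq, Fin.cons_zero, Fin.cons_succ,
    Set.mem_Icc] at ht ⊢
  exact fun h => ht ⟨h.1, h.2, hk⟩

/-- Joint moments of an axis measure pushed to the momentum `k`:
`∫ λ^{|n|} cos(k'·z) d(t ↦ (t,k))_* ν = (∫ t^{|n|} dν) · cos(k·z)`. -/
theorem integral_map_cons (k : Fin 2 → ℝ) (ν : Measure ℝ) (n : ℤ) (z : Fin 2 → ℤ) :
    ∫ p, (p 0) ^ n.natAbs * Real.cos (∑ j : Fin 2, p j.succ * (z j : ℝ))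
      ∂(ν.map (fun t : ℝ => (Fin.cons t k : Fin 3 → ℝ))) =
      (∫ t, t ^ n.natAbs ∂ν) * Real.cos (∑ i : Fin 2, k i * (z i : ℝ)) := by
  rw [integral_map (measurable_cons k).aemeasurable
    (Continuous.aestronglyMeasurable (by fun_prop))]
  simp only [Fin.cons_zero, Fin.cons_succ]
  exact integral_mul_const _ _

/-- Powers are integrable against a finite measure carried by `[0,1]`. -/
theorem integrable_pow {ν : Measure ℝ} [IsFiniteMeasure ν] (hν : ν (Set.Icc (0 : ℝ) 1)ᶜ = 0)
    (k : ℕ) : Integrable (fun t : ℝ => t ^ k) ν := by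
  refine Integrable.mono' (integrable_const (1 : ℝ)) (by fun_prop) ?_
  have h : ∀ᵐ t ∂ν, t ∈ Set.Icc (0 : ℝ) 1 := mem_ae_iff.2 hν
  filter_upwards [h] with t ht
  rw [Real.norm_eq_abs, abs_of_nonneg (pow_nonneg ht.1 _)]
  exact pow_le_one₀ ht.1 ht.2

/-- The joint kernel `λ^{|n|} cos(k'·z)` is integrable against a finite axis measure carried by
`[0,1]` pushed to the momentum `k`. -/
theorem integrable_map_cons (k : Fin 2 → ℝ) (ν : Measure ℝ) [IsFiniteMeasure ν]
    (hν : ν (Set.Icc (0 : ℝ) 1)ᶜ = 0) (n : ℤ) (z : Fin 2 → ℤ) :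
    Integrable (fun p : Fin 3 → ℝ => (p 0) ^ n.natAbs * Real.cos (∑ j : Fin 2, p j.succ * (z j : ℝ)))
      (ν.map (fun t : ℝ => (Fin.cons t k : Fin 3 → ℝ))) := by
  rw [integrable_map_measure (Continuous.aestronglyMeasurable (by fun_prop))
    (measurable_cons k).aemeasurable]
  simpa only [Function.comp_def, Fin.cons_zero, Fin.cons_succ] using
    (integrable_pow hν n.natAbs).mul_const (Real.cos (∑ i : Fin 2, k i * (z i : ℝ)))

/-- The diagonal pair count: `#{(x,y) ∈ [0,N)² × [0,N)² : x - y = 0} = N²`. -/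
theorem card_filter_sub_eq_zero (N : ℕ) :
    (((Fintype.piFinset (fun _ : Fin 2 => Finset.Ico (0 : ℤ) N)) ×ˢ
        (Fintype.piFinset (fun _ : Fin 2 => Finset.Ico (0 : ℤ) N))).filter
        (fun xy => xy.1 - xy.2 = 0)).card = N ^ 2 := by
  have h : ((Fintype.piFinset (fun _ : Fin 2 => Finset.Ico (0 : ℤ) N)) ×ˢ
      (Fintype.piFinset (fun _ : Fin 2 => Finset.Ico (0 : ℤ) N))).filter
      (fun xy => xy.1 - xy.2 = 0) =
        (Fintype.piFinset (fun _ : Fin 2 => Finset.Ico (0 : ℤ) N)).diag := by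
    rw [Finset.diag_eq_filter]
    exact Finset.filter_congr (fun xy _ => sub_eq_zero)
  rw [h, Finset.diag_card, Fintype.card_piFinset_const, Int.card_Ico, sub_zero, Int.toNat_natCast]

/-- The normalisation: `(N²(2N)²)⁻¹ · ((2N)² · A · B) = A/N² · B`. -/
theorem weight_identity {N : ℝ} (hN : N ≠ 0) (A B : ℝ) :
    (N ^ 2 * (2 * N) ^ 2)⁻¹ * ((2 * N) ^ 2 * A * B) = A / N ^ 2 * B := by
  field_simp

/-- `Fin.cons 0 0 = 0` in `ℤ³`. -/
theorem cons_zero_zero : (Fin.cons (0 : ℤ) (0 : Fin 2 → ℤ) : Fin 3 → ℤ) = 0 := by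
  ext i
  refine Fin.cases ?_ (fun k => ?_) i <;> simp

end CriticalTwoPointGSMJs.JsApproximants

open CriticalTwoPointGSMJs.JsApproximants in
/-- **STUB `js_approximants` (the finite-`N` joint spectral measures).** Given the collapsed
identity of `js_cesaroIdentity`: for every `N ≥ 1` there is a probability measure `ρ_N` on `ℝ³`
carried by `[0,1]×[-π,π]²` whose joint moments `∫ λ^{|n|} cos(k·z) dρ_N` equal the Cesàro-weighted
two-point function `#{(x,y) ∈ [0,N)⁴ : x-y = z}·G(n,z)/N²` for all `n` and all `|zᵢ| < N`
(`ρ_N = (N²(2N)²)⁻¹ ∑_j (μ_{cos,j} + μ_{sin,j}) ⊗ δ_{k_j}` with the Hausdorff measures of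
`Theorems.mixedSpectralRepresentation_proof`). -/
theorem js_approximants
    (hces : ∀ N : ℕ, 1 ≤ N → ∀ (n : ℤ) (z : Fin 2 → ℤ), (∀ i : Fin 2, |z i| < N) →
      ∑ j ∈ Fintype.piFinset (fun _ : Fin 2 => Finset.Ioc (-(N : ℤ)) N),
        Real.cos (∑ i : Fin 2, Real.pi * (j i : ℝ) * (z i : ℝ) / N) *
          ∑ x ∈ Fintype.piFinset (fun _ : Fin 2 => Finset.Ico (0 : ℤ) N),
            ∑ y ∈ Fintype.piFinset (fun _ : Fin 2 => Finset.Ico (0 : ℤ) N),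
              (Real.cos (∑ i : Fin 2, Real.pi * (j i : ℝ) * (x i : ℝ) / N) *
                  Real.cos (∑ i : Fin 2, Real.pi * (j i : ℝ) * (y i : ℝ) / N) +
                Real.sin (∑ i : Fin 2, Real.pi * (j i : ℝ) * (x i : ℝ) / N) *
                  Real.sin (∑ i : Fin 2, Real.pi * (j i : ℝ) * (y i : ℝ) / N)) *
              criticalTwoPoint 3 (Fin.cons n (x - y)) =
      (2 * (N : ℝ)) ^ 2 *
        ((((Fintype.piFinset (fun _ : Fin 2 => Finset.Ico (0 : ℤ) N)) ×ˢ
            (Fintype.piFinset (fun _ : Fin 2 => Finset.Ico (0 : ℤ) N))).filter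
            (fun xy => xy.1 - xy.2 = z)).card : ℝ) *
        criticalTwoPoint 3 (Fin.cons n z)) :
    ∀ N : ℕ, 1 ≤ N → ∃ ρ : Measure (Fin 3 → ℝ), IsProbabilityMeasure ρ ∧
      ρ {p | 0 ≤ p 0 ∧ p 0 ≤ 1 ∧ ∀ j : Fin 2, -Real.pi ≤ p j.succ ∧ p j.succ ≤ Real.pi}ᶜ = 0 ∧
      ∀ (n : ℤ) (z : Fin 2 → ℤ), (∀ i : Fin 2, |z i| < N) →
        ∫ p, (p 0) ^ n.natAbs * Real.cos (∑ j : Fin 2, p j.succ * (z j : ℝ)) ∂ρ =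
          ((((Fintype.piFinset (fun _ : Fin 2 => Finset.Ico (0 : ℤ) N)) ×ˢ
              (Fintype.piFinset (fun _ : Fin 2 => Finset.Ico (0 : ℤ) N))).filter
              (fun xy => xy.1 - xy.2 = z)).card : ℝ) / (N : ℝ) ^ 2 *
            criticalTwoPoint 3 (Fin.cons n z) := by
  intro N hN
  have hN0 : (N : ℝ) ≠ 0 := by exact_mod_cast Nat.one_le_iff_ne_zero.1 hN
  -- the Hausdorff measures of all real coefficient vectors on the box `[0,N)²`
  choose μ hfin hsupp hspec using
    exists_hausdorff (Fintype.piFinset (fun _ : Fin 2 => Finset.Ico (0 : ℤ) N))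
  -- the cosine / sine coefficient vectors at the momentum `k_j = πj/N` (local abbreviations)
  obtain ⟨vc, hvc⟩ : ∃ vc : (Fin 2 → ℤ) → (Fin 2 → ℤ) → ℝ,
      vc = fun j x => Real.cos (∑ i : Fin 2, Real.pi * (j i : ℝ) * (x i : ℝ) / N) := ⟨_, rfl⟩
  obtain ⟨vs, hvs⟩ : ∃ vs : (Fin 2 → ℤ) → (Fin 2 → ℤ) → ℝ,
      vs = fun j x => Real.sin (∑ i : Fin 2, Real.pi * (j i : ℝ) * (x i : ℝ) / N) := ⟨_, rfl⟩
  -- the axis measure `μ_{c,j} + μ_{s,j}` at the momentum `j`: support and moments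
  have hsupp2 : ∀ j : Fin 2 → ℤ, (μ (vc j) + μ (vs j)) (Set.Icc (0 : ℝ) 1)ᶜ = 0 := fun j => by
    rw [Measure.add_apply, hsupp, hsupp, add_zero]
  have hmom1 : ∀ (j : Fin 2 → ℤ) (n : ℤ), ∫ t, t ^ n.natAbs ∂(μ (vc j) + μ (vs j)) =
      ∑ x ∈ Fintype.piFinset (fun _ : Fin 2 => Finset.Ico (0 : ℤ) N),
        ∑ y ∈ Fintype.piFinset (fun _ : Fin 2 => Finset.Ico (0 : ℤ) N),
          (vc j x * vc j y + vs j x * vs j y) * criticalTwoPoint 3 (Fin.cons n (x - y)) := by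
    intro j n
    rw [integral_add_measure (integrable_pow (hsupp _) _) (integrable_pow (hsupp _) _),
      ← hspec, ← hspec]
    simp only [add_mul, Finset.sum_add_distrib]
  -- the joint moments of `ρ_N := (N²(2N)²)⁻¹ ∑_j (t ↦ (t, k_j))_* (μ_{c,j} + μ_{s,j})`
  have hmom : ∀ (n : ℤ) (z : Fin 2 → ℤ), (∀ i : Fin 2, |z i| < N) →
      ∫ p, (p 0) ^ n.natAbs * Real.cos (∑ j : Fin 2, p j.succ * (z j : ℝ))
        ∂(((N : NNReal) ^ 2 * (2 * N) ^ 2)⁻¹ •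
          ∑ j ∈ Fintype.piFinset (fun _ : Fin 2 => Finset.Ioc (-(N : ℤ)) N),
            (μ (vc j) + μ (vs j)).map
              (fun t : ℝ => (Fin.cons t (fun i : Fin 2 => Real.pi * (j i : ℝ) / N) : Fin 3 → ℝ))) =
          ((((Fintype.piFinset (fun _ : Fin 2 => Finset.Ico (0 : ℤ) N)) ×ˢ
              (Fintype.piFinset (fun _ : Fin 2 => Finset.Ico (0 : ℤ) N))).filter
              (fun xy => xy.1 - xy.2 = z)).card : ℝ) / (N : ℝ) ^ 2 *
            criticalTwoPoint 3 (Fin.cons n z) := by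
    intro n z hz
    rw [integral_smul_nnreal_measure,
      integral_finsetSum_measure (fun j _ => integrable_map_cons _ _ (hsupp2 j) n z)]
    have h2 : ∑ j ∈ Fintype.piFinset (fun _ : Fin 2 => Finset.Ioc (-(N : ℤ)) N),
        ∫ p, (p 0) ^ n.natAbs * Real.cos (∑ j : Fin 2, p j.succ * (z j : ℝ))
          ∂((μ (vc j) + μ (vs j)).map
            (fun t : ℝ => (Fin.cons t (fun i : Fin 2 => Real.pi * (j i : ℝ) / N) : Fin 3 → ℝ))) =
        (2 * (N : ℝ)) ^ 2 *
          ((((Fintype.piFinset (fun _ : Fin 2 => Finset.Ico (0 : ℤ) N)) ×ˢ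
              (Fintype.piFinset (fun _ : Fin 2 => Finset.Ico (0 : ℤ) N))).filter
              (fun xy => xy.1 - xy.2 = z)).card : ℝ) *
          criticalTwoPoint 3 (Fin.cons n z) := by
      rw [← hces N hN n z hz]
      refine Finset.sum_congr rfl (fun j _ => ?_)
      rw [integral_map_cons, hmom1, mul_comm]
      subst hvc hvs
      simp only [div_mul_eq_mul_div]
    rw [h2, NNReal.smul_def, smul_eq_mul]
    simp only [NNReal.coe_inv, NNReal.coe_mul, NNReal.coe_pow, NNReal.coe_natCast,
      NNReal.coe_ofNat]
    exact weight_identity hN0 _ _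
  refine ⟨_, ⟨?_⟩, ?_, hmom⟩
  · -- total mass one: the moment identity at `n = 0`, `z = 0`
    rw [← ENNReal.toReal_eq_one_iff]
    have h1 := hmom 0 0 (fun i => by simp only [Pi.zero_apply, abs_zero]; exact_mod_cast hN)
    simp only [Int.natAbs_zero, pow_zero, Pi.zero_apply, Int.cast_zero, mul_zero,
      Finset.sum_const_zero, Real.cos_zero, mul_one, integral_const, smul_eq_mul,
      measureReal_def] at h1
    rw [h1, card_filter_sub_eq_zero, cons_zero_zero, criticalTwoPoint_zero', Nat.cast_pow, mul_one,
      div_self (pow_ne_zero 2 hN0)]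
  · -- carried by the box `[0,1]×[-π,π]²`
    rw [Measure.smul_apply, Measure.finsetSum_apply, Finset.sum_eq_zero
      (fun j hj => map_cons_compl_box (fun i => momentum_mem hN hj i) _ (hsupp2 j)), smul_zero]

end Summit.CriticalPhenomena.Ising3DConformalLimit.Theorems

end
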